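import Summits.ResolutionOfSingularities.ResolutionOfSingularities.Theorems.HomologicalConductorNoZenoNodeBlowupResolution
import Summits.ResolutionOfSingularities.ResolutionOfSingularities.Theorems.HomologicalConductorNoZenoBaseIdealBlowupLift
import Summits.ResolutionOfSingularities.ResolutionOfSingularities.Theorems.HomologicalConductorSurfaceTerminationChartResolutionTower
import Summits.ResolutionOfSingularities.ResolutionOfSingularities.Theorems.HomologicalConductorNoZenoSplitExcCount
import Literature.AlgebraicGeometry.Resolution.ExceptionalPointsFinite
import Literature.AlgebraicGeometry.Resolution.ExceptionalCurvePoints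
import HarnessLib

/-!
# Crux `NoZenoR` / `NoZeno` (stmt-ResolutionOfSingularities-19943 / -16483) — slot 5 (B1) closer, seam 1 piece (1β): THE CHART DATA OF A
# SEP-X¹-SANDWICHED GERM — the node blow-up `X¹` is a resolution, its function field is `K`, and `X¹` maps to the blow-up of the base ideal

Route `ResolutionOfSingularities/HomologicalConductor`, W4.4 chain, slot 5 `stub_L1wCoreF3`, closer skeleton
`L/res-L0-w44-lead-1/L1wCoreCloser-SKELETON.lean` d2cae9e6707cd6ee step (2) «σ_B → chart resolution → …» (res-L0-w44-plan-1 DESK WORD 15: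
`seam1_upstairs` → res-L0-w44-stub-3; this is sub-piece (1β) of the hand's DESIGN CENSUS 20:09:52Z, now unblocked by res-L1-type-o5's (1δ)
`NodeBlowup.isResolution_comp`, p568319).  A BY-NAME COMPOSITION producing, from the habitat hypothesis `IsSepX1Sandwiched T' I` of a local
normal two-dimensional `k`-subalgebra `T' ⊆ K` (`Frac T' = K`) and a base ideal `I` with `√I = 𝔪` containing a non-zero `x`, exactly the
data the chart-germ resolution package `exists_chartGermResolution` (p566359) consumes:

* the minimal resolution `π : X → Spec T'`, the node blow-up `ρ : X¹ → X`, the principality clause of `I·𝒪_{X¹}` (unpacked from 𝓢);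
* `(excCurvePoints π).Finite` (`excPoints_finite` + `IsResolution.excCurvePoints_subset_excPoints`);
* **`IsResolution (ρ ≫ π)`** and `IsIntegral X¹` (o5's `NodeBlowup.isResolution_comp` / `NodeBlowup.isIntegral`);
* the function-field identification `e : K(X¹) ≃+* K` over `T'` (`ChartResolution.exists_functionField_ringEquiv`);
* the lift **`σ_B : X¹ → Bl_I(Spec T')` over `Spec T'`** (the lead's `exists_lift_affineBlowup`, p563736: `I ≠ ⊥`, `𝔪^c ≤ I` from `√I = 𝔪`
  by `Ideal.exists_pow_le_of_le_radical_of_fg`, and the principality clause).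

Def-free, fact-free; `--supports 19943 --as helper`.  OURS (cell res-hironaka): AI-produced and kernel-checked, weaker than expert review;
nothing here is a statement of the manuscript under review (Hironaka 2017); counted 0.
-/

noncomputable section

-- single-problem summit: the doubled namespace component `ResolutionOfSingularities` is forced
set_option linter.dupNamespace false

open CategoryTheory CategoryTheory.Limits AlgebraicGeometry TopologicalSpace Opposite IsLocalRing
open Literature.AlgebraicGeometry.Resolution Literature.AlgebraicGeometry.Motives
open Summit.ResolutionOfSingularities.ResolutionOfSingularities.Theorems.SurfaceTermination

namespace Summit.ResolutionOfSingularities.ResolutionOfSingularities.Theorems.NoZeno.ExcCount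

variable {k K : Type} [Field k] [Field K] [Algebra k K]

/-- `√I = 𝔪` in a Noetherian local ring gives `𝔪^c ≤ I` for some `c` (Mathlib `Ideal.exists_pow_le_of_le_radical_of_fg`). [folklore] -/
theorem exists_maximalIdeal_pow_le_of_radical_eq {R : Type} [CommRing R] [IsLocalRing R] [IsNoetherianRing R]
    {I : Ideal R} (hrad : I.radical = maximalIdeal R) : ∃ c : ℕ, maximalIdeal R ^ c ≤ I :=
  Ideal.exists_pow_le_of_le_radical_of_fg (hrad ▸ le_rfl) (IsNoetherian.noetherian _)

/-- **Finitely many exceptional curves** for any resolution of a two-dimensional Noetherian local domain: the integral exceptional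
curves are components of the closed fibre (`IsResolution.excCurvePoints_subset_excPoints`), and those are finitely many
(`excPoints_finite`). [folklore] -/
theorem excCurvePoints_finite_of_isResolution {T : Type} [CommRing T] [IsNoetherianRing T] [IsDomain T] [IsLocalRing T]
    {X : Scheme.{0}} {π : X ⟶ Spec (.of T)} (h2 : ringKrullDim T = 2) (hπ : IsResolution π) :
    (excCurvePoints π).Finite := by
  haveI := hπ.isProper
  exact (excPoints_finite π).subset (IsResolution.excCurvePoints_subset_excPoints h2 hπ)

/-- **THE CHART DATA OF A SEP-X¹-SANDWICHED GERM (seam 1, piece (1β)).**  Let `T' ⊆ K` be a `k`-subalgebra which is a Noetherian normal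
LOCAL domain of Krull dimension `2` with `Frac T' = K`, `I ⊆ T'` an ideal with `√I = 𝔪` containing an element `x ≠ 0`, and assume the
habitat clause `IsSepX1Sandwiched T' I` (a minimal resolution `π : X → Spec T'`, the blow-up `ρ : X¹ → X` of the closure of the separable
nodes, and `I·𝒪_{X¹}` principal at every point over the closed point).  Then `X¹` is integral, `ρ ≫ π` is a RESOLUTION with finitely many
exceptional curves downstairs, its function field is identified with `K` over `T'`, and `ρ ≫ π` factors through the blow-up of `I`:
`σ_B : X¹ → Bl_I(Spec T')`, `σ_B ≫ π_I = ρ ≫ π` — the input of `exists_chartGermResolution` with `T := T'`, `Z := X¹`. OURS. [folklore] -/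
theorem exists_chartData_of_isSepX1Sandwiched (T' : Subalgebra k K) [IsNoetherianRing ↥T'] [IsLocalRing ↥T']
    [IsIntegrallyClosed ↥T'] [IsFractionRing ↥T' K] (hdim : ringKrullDim ↥T' = 2)
    (I : Ideal ↥T') (hrad : I.radical = maximalIdeal ↥T') {x : ↥T'} (hxI : x ∈ I) (hx0 : (x : K) ≠ 0)
    (hS : IsSepX1Sandwiched ↥T' I) :
    ∃ (X : Scheme.{0}) (π : X ⟶ Spec (.of ↥T')) (_ : IsMinimalResolution π) (_ : (excCurvePoints π).Finite)
      (X1 : Scheme.{0}) (_ : IsIntegral X1) (ρ : X1 ⟶ X)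
      (_ : IsBlowup ρ (Scheme.IdealSheafData.vanishingIdeal ⟨closure (sepNodes π), isClosed_closure⟩))
      (_ : ∀ x₁ : X1, IsLocalHom (toStalk (ρ ≫ π) x₁) → (I.map (toStalk (ρ ≫ π) x₁)).IsPrincipal)
      (_ : IsResolution (ρ ≫ π))
      (e : ↑X1.functionField ≃+* K) (_ : ∀ t : ↥T', e (baseToFunctionField (ρ ≫ π) t) = (t : K))
      (σB : X1 ⟶ affineBlowup I), σB ≫ affineBlowup.π I = ρ ≫ π := by
  obtain ⟨X, π, hπmin, X1, ρ, hρ, hprinc⟩ := hS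
  have hπ : IsResolution π := hπmin.isResolution
  haveI : IsProper π := hπ.isProper
  haveI : IsIntegral X := hπ.isIntegral_source
  have hfin : (excCurvePoints π).Finite := excCurvePoints_finite_of_isResolution hdim hπ
  have hres : IsResolution (ρ ≫ π) := NodeBlowup.isResolution_comp π ρ hfin hπ hρ
  haveI : IsIntegral X1 := NodeBlowup.isIntegral π ρ hfin hρ
  haveI : IsProper (ρ ≫ π) := hres.isProper
  haveI : IsDominant (ρ ≫ π) := hres.isBirational.isDominant
  haveI : IsLocallyNoetherian X1 := LocallyOfFiniteType.isLocallyNoetherian (ρ ≫ π)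
  obtain ⟨e, he⟩ := ChartResolution.exists_functionField_ringEquiv T' (ρ ≫ π) hres.isBirational
  have hI0 : I ≠ ⊥ := fun h => by
    apply hx0
    have : x = 0 := by simpa [h] using hxI
    rw [this]; rfl
  obtain ⟨c, hc⟩ := exists_maximalIdeal_pow_le_of_radical_eq hrad
  obtain ⟨σB, hσB⟩ := exists_lift_affineBlowup (ρ ≫ π) I hI0 hc hprinc
  exact ⟨X, π, hπmin, hfin, X1, inferInstance, ρ, hρ, hprinc, hres, e, he, σB, hσB⟩

end Summit.ResolutionOfSingularities.ResolutionOfSingularities.Theorems.NoZeno.ExcCount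

end
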